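import Literature.Geometry.Lorentzian.KerrData
import Literature.Geometry.Lorentzian.InducedVacuumData
import Literature.Geometry.Lorentzian.LeviCivitaProofs
import HarnessLib

/-!
# Stub `stub_inducedVacuumData` (line `plug-the-second-sheet`, crux `KerrShieldedDataExist`)

Support file (`--supports stmt-FinalStateConjecture-10055`) for the thesis
`Summit.FinalStateConjecture.FinalStateConjecture.Theses.SwallowTheDatum.KerrShieldedDataExist`:
the registered stub `stub_inducedVacuumData` of the line skeleton
`Cruxes/KerrShieldedDataExist/Lines/plug-the-second-sheet.lean`, proved verbatim. It is the GENERIC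
PACKAGING step of the harvest: every piece of the final datum is the pair `(f^* g, K_ν)` induced on
a chart domain `U ⊆ E3` by an explicit smooth spacelike immersion `f : U → Kerr.region 0 r₀` into
the Ricci-flat Kerr–Schild Schwarzschild chart with an explicit smooth unit normal `ν`; this file
turns such `(f, ν)` into an honest `InitialDataSet 𝓘(ℝ, E3) U` with the induced metric, with
`k = K_ν` (the prelude's `secondFundamentalForm`, sign `K_ν(v, w) = + g(D_v ν, df w)`), solving the
vacuum constraints. All the mathematics is the tree's
`Literature/Geometry/Lorentzian/InducedVacuumData.lean`
(`PseudoRiemannianMetric.exists_initialDataSet_induced_isVacuumConstraintSolution`: `K_ν` is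
symmetric and smooth, O'Neill 1983, Ch. 4, Lemma 4 and Lemma 4.4; the constraints are the
twice-traced Gauss and the traced Codazzi equations, Choquet-Bruhat 2009, Ch. VI, Thm. 3.3),
specialised to `g = Kerr.smoothMetric M 0 r₀` (canonical Levi-Civita instance
`PseudoRiemannianMetric.hasLeviCivita`; `dim E3 = 3`, `dim E4 = 3 + 1`), the smooth lift of `ν`
being read off its smooth representative `N` (`OpensChart.contMDiff_lift_of_contDiffOn`).

## References

* Y. Choquet-Bruhat, *General Relativity and the Einstein Equations*, OUP 2009, Ch. VI, Thm. 3.3.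
* B. O'Neill, *Semi-Riemannian geometry with applications to relativity*, Academic Press 1983,
  Ch. 4, Lemma 4 and Lemma 4.4.
-/

noncomputable section

set_option linter.dupNamespace false

namespace Summit.FinalStateConjecture.FinalStateConjecture.Theorems.SwallowTheDatum

open Bundle Literature.Geometry.Lorentzian
open scoped Manifold ContDiff Topology

/-- **Stub `stub_inducedVacuumData` of line `plug-the-second-sheet` (crux `KerrShieldedDataExist`):
the vacuum initial data set induced on a spacelike immersed chart domain of Kerr–Schild
Schwarzschild.** For every mass `M`, inner radius `r₀`, chart domain `U ⊆ E3` and map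
`f : U → Kerr.region 0 r₀` into the Schwarzschild (`a = 0`) Kerr–Schild chart with a field `ν`
along it such that: `Ric(g_{M,0}) = 0` on the chart (for every proof of the Levi-Civita
hypothesis), `f` and `ν` have representatives `Φ, N : E3 → E4` of class `C^∞` on `U`, `f` is a
spacelike immersion and `ν` a unit normal of sign `−1`, there is an `InitialDataSet` `D` on `U` whose
metric is the induced one `f^* g`, whose tensor `k` is the second fundamental form `K_ν`
(`K_ν(v, w) = + g(D_v ν, df w)`, for every proof of the Levi-Civita hypothesis — all proofs of this
`Prop` agree) and which solves the vacuum constraint equations. This is the generic packaging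
`PseudoRiemannianMetric.exists_initialDataSet_induced_isVacuumConstraintSolution`
(`Literature/Geometry/Lorentzian/InducedVacuumData.lean`: symmetry and smoothness of `K_ν` by
O'Neill 1983, Ch. 4, Lemma 4 and 4.4; the constraints by the twice-traced Gauss and traced Codazzi
equations, Choquet-Bruhat 2009, Ch. VI, Thm. 3.3) at `g = Kerr.smoothMetric M 0 r₀` with its
canonical Levi-Civita instance `PseudoRiemannianMetric.hasLeviCivita`, the smooth lift of `ν` coming
from the representative `N` (`OpensChart.contMDiff_lift_of_contDiffOn`) and `dim E3 = 3`,
`dim E4 = 3 + 1`. (The representative `Φ` is not needed: smoothness of `f` is part of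
`IsSpacelikeImmersion`.) [cite: ChoquetBruhat2009, Ch. VI, Thm. 3.3] -/
theorem stub_inducedVacuumData :
    ∀ [Kerr.Facts] (M r₀ : ℝ) (U : TopologicalSpace.Opens E3) (Φ N : E3 → E4)
      (f : U → Kerr.region 0 r₀) (ν : NormalField 𝓘(ℝ, E4) f),
      (∀ [(Kerr.smoothMetric M 0 r₀).HasLeviCivita] (x : Kerr.region 0 r₀), (Kerr.smoothMetric M 0 r₀).ricci x = 0) →
      (∀ y : U, ((f y : Kerr.region 0 r₀) : E4) = Φ y) → (∀ y : U, ν y = N y) →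
      ContDiffOn ℝ ∞ Φ (U : Set E3) → ContDiffOn ℝ ∞ N (U : Set E3) →
      (Kerr.smoothMetric M 0 r₀).IsSpacelikeImmersion 𝓘(ℝ, E3) f →
      (Kerr.smoothMetric M 0 r₀).IsUnitNormal 𝓘(ℝ, E3) f ν (-1) →
      ∃ D : InitialDataSet 𝓘(ℝ, E3) U,
        (∀ y : U, D.h.inner y = (Kerr.smoothMetric M 0 r₀).inducedBilin 𝓘(ℝ, E3) f y) ∧
        (∀ [(Kerr.smoothMetric M 0 r₀).HasLeviCivita] (y : U),
          (D.k y).toLinearMap₁₂ = (Kerr.smoothMetric M 0 r₀).secondFundamentalForm 𝓘(ℝ, E3) f ν y) ∧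
        (∀ [D.metric.HasLeviCivita], D.IsVacuumConstraintSolution) := by
  intro _ M r₀ U _ N f ν hRic _ hνN _ hN hfi hun
  haveI hLC : (Kerr.smoothMetric M 0 r₀).HasLeviCivita :=
    (Kerr.smoothMetric M 0 r₀).toPseudoRiemannianMetric.hasLeviCivita
  have hνs : ContMDiff 𝓘(ℝ, E3) 𝓘(ℝ, E4).tangent ∞
      (fun y : U ↦ (TotalSpace.mk' E4 (f y) (ν y) : TangentBundle 𝓘(ℝ, E4) (Kerr.region 0 r₀))) :=
    OpensChart.contMDiff_lift_of_contDiffOn hfi.contMDiff_self hνN hN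
  have hm : Module.finrank ℝ E3 = 3 := finrank_euclideanSpace_fin
  have hm1 : Module.finrank ℝ E4 = 3 + 1 := finrank_euclideanSpace_fin
  obtain ⟨D, hDh, hDk, hDvac⟩ :=
    (Kerr.smoothMetric M 0 r₀).toPseudoRiemannianMetric.exists_initialDataSet_induced_isVacuumConstraintSolution
      hfi hun hνs hm hm1 (fun y ↦ hRic (f y))
  exact ⟨D, hDh, fun y ↦ hDk y, hDvac⟩

end Summit.FinalStateConjecture.FinalStateConjecture.Theorems.SwallowTheDatum

end
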